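import Summits.QuantumFields.BalabanUV.Beta.EriceFlowEnclosureB12AsPrintedTunedUpper

/-!
# Beta / EriceFlowEnclosureB12AsPrintedEnd — END of ROW AP-I: the bare coupling g₀(ε, g) of Theorem 2's tuned runs is two-sided logarithmic,
# lower constant from Theorem 2, UPPER CONSTANT FROM PRINT ((5.10)∕(5.42) via Theorem 3); and one END statement «what the as-printed
# interface of [I] plus the β sub-cell's three box letters deliver» (β-flow team, prover 1, unit `b2b-balaban-beta-bflow-p1`, gen 32;
# ROW AP-I; closes the series `…B12AsPrintedUpper` → `…Tuned` → `…TunedUpper`)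

HONEST FRAMING (page 1 of everything the β sub-cell writes): discharging `BetaPertH` makes Bałaban's UV stability UNCONDITIONAL — a
real constructive-QFT result; it is NOT the continuum limit and NOT the Clay problem.  HONEST DEPENDENCY (cell reorg 2026-08-19,
verbatim): «continuum YM on T⁴ ⇐ BetaPertH ∧ nine spine estimates (0/9 proved); BetaPertH ⇐ (D1) ∧ (D4) ∧ CAP+tail; G-an2-4 gates
asym, D1 and NE2/3/4.»  THIS MODULE DISCHARGES NOTHING of the wall: bookkeeping over the NAMED FIELDS of `B12BetaAsPrinted` ([I] =
[Balaban1987RG1] as typed, p537882 ✓ ∕ v1.1 p539116 ✓) — `Theorem2Statement` (STATED WITHOUT PROOF in print), `Definitions`, `Conclusions`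
(Theorem 3) — and the sub-cell's LETTERS (U) `BetaUpperH`, the sign ∕ AF letter `BetaLowerH`, `BetaContH`; all HYPOTHESES on an abstract
`Setting`; nothing of Bałaban's objects asserted.

WHAT THIS FILE PROVES (0 sorry, 0 def):
§1 `bare_twoSided_of_discrete031` (k = 0 of a discrete running: `1∕g² + b·K ≤ 1∕g₀² ≤ 1∕g² + β′·K`); **`bareCoupling_twoSided_of_upper`**
   (`Theorem2Statement` + `Definitions ∧ Conclusions` + (U) ⟹ for every m, γ ≤ γ₁, g ≤ g₁: ∃ β > 0 with β·ln L ≤ β′₅₁₀ such that at EVERY K the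
   tuned bare coupling obeys **`1∕g² + β·ln L·K ≤ 1∕g₀(ε, g)² ≤ 1∕g² + β′₅₁₀·K`**, K = log_L ε⁻¹ — the bare coupling is asymptotically free at
   a two-sided LOGARITHMIC rate whose UPPER constant β′₅₁₀ = C510·E₀·Σ_x|x|₁²e^{−δ₁|x|₁} is the one [I]+[II] PROVE ((5.10) + (5.42) through
   Theorem 3), only the lower one coming from the unproved Theorem 2).
§2 **`rowAPI_end`** — ONE END STATEMENT: `StandingHypotheses ∧ Definitions ∧ Conclusions` + joint continuity + `0 < b ≤ β_{k+1} ≤ b′` on the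
   boxes ]0, γ₀]^{k+1} ⟹ (i) `Theorem2Statement S hL` ([I] Thm 2 AS PRINTED, `…Upper.theorem2Statement_of_letters`), and (ii) for every m,
   small γ and g: tuned runs WITH THEOREM 3's RUN HYPOTHESIS `RunHyp`, g_K = g, print's bound |β_{j+1}| ≤ β′₅₁₀ along them, the per-step
   (0.31) with upper constant min(β′ ln L, β′₅₁₀), the rate condition β·ln L ≤ β′₅₁₀ and the two-sided bare-coupling law of §1
   (`…TunedUpper.theorem2_rate_le_betaPrime510_of_upper`).  Everything a consumer of «Theorem 2 + Theorem 3» reads on this carrier, from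
   the printed fields and the three letters, BY NAME.
NOT CLAIMED: the letters, Theorem 2 or any interface field for the construction; `BetaPertH`; continuum; Clay.
-/

namespace Summit.QuantumFields.BalabanUV.Beta.EriceFlowEnclosureB12AsPrintedEnd

open Literature.MathematicalPhysics.QuantumFieldTheory.Balaban1983to89
open Literature.MathematicalPhysics.QuantumFieldTheory.Balaban1983to89.B12BetaAsPrinted
open Literature.MathematicalPhysics.QuantumFieldTheory.Balaban1983to89.B12Sec2to5 (betaPrime510)
open Literature.MathematicalPhysics.QuantumFieldTheory.Balaban1983to89.FlowStep (prefixOf Box BetaContH BetaLowerH BetaUpperH)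
open Summit.QuantumFields.BalabanUV.Beta.EriceFlowEnclosureB12AsPrintedUpper
open Summit.QuantumFields.BalabanUV.Beta.EriceFlowEnclosureB12AsPrintedTuned
open Summit.QuantumFields.BalabanUV.Beta.EriceFlowEnclosureB12AsPrintedTunedUpper

noncomputable section

variable {S : Setting}

/-! ## §1 The bare coupling of the tuned runs: two-sided logarithmic, upper constant from print -/

/-- k = 0 of a discrete running: the BARE end relative to the renormalized end, `1∕g² + b·K ≤ 1∕g₀² ≤ 1∕g² + β′·K`.
[cite: Balaban1987RG1, Thm 2 (0.31) p.259 (k = 0)] -/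
theorem bare_twoSided_of_discrete031 {b β' : ℝ} {K : ℕ} {g : ℝ} {gs : ℕ → ℝ} (h : Step.Discrete031 b β' K g gs) :
    1 / g ^ 2 + b * K ≤ 1 / (gs 0) ^ 2 ∧ 1 / (gs 0) ^ 2 ≤ 1 / g ^ 2 + β' * K := by
  have h0 := h 0 (Nat.zero_le K)
  simp only [Nat.cast_zero, sub_zero] at h0
  exact h0

/-- **THE BARE COUPLING g₀(ε, g) IS ASYMPTOTICALLY FREE AT A TWO-SIDED LOGARITHMIC RATE, UPPER CONSTANT FROM PRINT.**  `Theorem2Statement S hL`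
+ the printed `Definitions ∧ Conclusions` + the upper letter (U) on ]0, γu] ⟹ for every m there is γ₁ > 0 such that for every γ ≤ γ₁ and
every small renormalized g there is β > 0 with β·ln L ≤ β′₅₁₀ and, at EVERY number of steps K = log_L ε⁻¹, a bare coupling g₀ = g₀(ε, g) of a
Theorem-3 run (`RunHyp`) ending at g with `1∕g² + β·ln L·K ≤ 1∕g₀² ≤ 1∕g² + β′₅₁₀·K`, β′₅₁₀ = betaPrime510 4 (C510·E₀) δ₁ — (0.31) at k = 0 with
the upper constant [I]+[II] PROVE. [cite: Balaban1987RG1, Thm 2 (0.31) p.259 with (5.10) p.293, (5.42) p.297; Balaban1989LargeFieldII, p.355] -/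
theorem bareCoupling_twoSided_of_upper {hL : Odd S.L ∧ 1 < S.L} (h : Theorem2Statement S hL) (hD : Definitions S)
    (hC : Conclusions S) {b' γu : ℝ} (hγu : 0 < γu) (hup : BetaUpperH b' γu S.β) (hSγ : 0 < S.γ) (m : ℕ) :
    ∃ γ₁ : ℝ, 0 < γ₁ ∧ ∀ γ : ℝ, 0 < γ → γ ≤ γ₁ → ∃ g₁ : ℝ, 0 < g₁ ∧ ∀ g : ℝ, 0 < g → g ≤ g₁ →
      ∃ β : ℝ, 0 < β ∧ β * Real.log S.L ≤ betaPrime510 4 (S.C510 * S.E₀) S.δ₁ ∧ ∀ K : ℕ, ∃ g₀ : ℝ,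
        RunHyp S ⟨K, m, g₀⟩ ∧ S.cpl ⟨K, m, g₀⟩ K = g ∧ S.cpl ⟨K, m, g₀⟩ 0 = g₀ ∧
          1 / g ^ 2 + β * Real.log S.L * K ≤ 1 / g₀ ^ 2 ∧ 1 / g₀ ^ 2 ≤ 1 / g ^ 2 + betaPrime510 4 (S.C510 * S.E₀) S.δ₁ * K := by
  obtain ⟨γ₁, hγ₁, hγ⟩ := theorem2_rate_le_betaPrime510_of_upper h hD hC hγu hup hSγ m
  refine ⟨γ₁, hγ₁, fun γ hγpos hγle => ?_⟩
  obtain ⟨g₁, hg₁, hg⟩ := hγ γ hγpos hγle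
  refine ⟨g₁, hg₁, fun g hgpos hgle => ?_⟩
  obtain ⟨β, β', hβ, -, hrate, hK⟩ := hg g hgpos hgle
  refine ⟨β, hβ, hrate, fun K => ?_⟩
  obtain ⟨g₀, hR, hend, -, hD031⟩ := hK K
  have h0 : S.cpl ⟨K, m, g₀⟩ 0 = g₀ := hD.d018 ⟨K, m, g₀⟩
  have hb := bare_twoSided_of_discrete031 hD031
  rw [h0] at hb
  refine ⟨g₀, hR, hend, h0, hb.1, hb.2.trans ?_⟩
  have hKn : (0 : ℝ) ≤ K := Nat.cast_nonneg K
  nlinarith [min_le_right (β' * Real.log S.L) (betaPrime510 4 (S.C510 * S.E₀) S.δ₁), hKn]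

/-! ## §2 END: what the as-printed interface of [I] plus the three box letters deliver, by name -/

/-- **ROW AP-I, END.**  For a setting with p. 251's ∕ Theorem 3's standing hypotheses, the printed `Definitions` and Theorem 3's printed
`Conclusions`, whose history-dependent β-functions are jointly continuous on the boxes ]0, γ₀]^{k+1} and obey `0 < b ≤ β_{k+1} ≤ b′` there
(the β sub-cell's LETTERS — the sign ∕ AF letter is the located unprinted input; (U) and continuity are printed on run sections only):
(i) [I]'s THEOREM 2 AS PRINTED holds (`Theorem2Statement S hL`); (ii) for every torus exponent m there is γ₁ > 0 such that for every
γ ≤ γ₁ and every small renormalized g there are Theorem-2 constants 0 < β ≤ β′ with **β·ln L ≤ β′₅₁₀** and, at every K, a bare coupling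
g₀(ε, g) whose run satisfies THEOREM 3's RUN HYPOTHESIS, ends at g, obeys print's bound |β_{j+1}(g₀, …, g_j)| ≤ β′₅₁₀ (j + 1 ≤ K) and the
per-step (0.31) with constants (β ln L, min(β′ ln L, β′₅₁₀)).  Composition BY NAME of `…Upper.theorem2Statement_of_letters` and
`…TunedUpper.theorem2_rate_le_betaPrime510_of_upper`. [cite: Balaban1987RG1, Thm 2 (0.31) p.259, Thm 3 p.264, (5.10) p.293; Balaban1989LargeFieldII, p.355] -/
theorem rowAPI_end (hH : StandingHypotheses S) (hD : Definitions S) (hC : Conclusions S) {γ₀ b b' : ℝ} (hγ₀ : 0 < γ₀)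
    (hb : 0 < b) (hbb' : b ≤ b') (hcont : BetaContH γ₀ S.β) (hlo : BetaLowerH b γ₀ S.β) (hup : BetaUpperH b' γ₀ S.β) :
    Theorem2Statement S (hL_of_standing hH) ∧
      ∀ m : ℕ, ∃ γ₁ : ℝ, 0 < γ₁ ∧ ∀ γ : ℝ, 0 < γ → γ ≤ γ₁ → ∃ g₁ : ℝ, 0 < g₁ ∧ ∀ g : ℝ, 0 < g → g ≤ g₁ →
        ∃ β β' : ℝ, 0 < β ∧ β ≤ β' ∧ β * Real.log S.L ≤ betaPrime510 4 (S.C510 * S.E₀) S.δ₁ ∧ ∀ K : ℕ, ∃ g₀ : ℝ,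
          RunHyp S ⟨K, m, g₀⟩ ∧ S.cpl ⟨K, m, g₀⟩ K = g ∧
            (∀ j, j + 1 ≤ K → |S.β j (prefixOf (S.cpl ⟨K, m, g₀⟩) j)| ≤ betaPrime510 4 (S.C510 * S.E₀) S.δ₁) ∧
            Step.Discrete031 (β * Real.log S.L) (min (β' * Real.log S.L) (betaPrime510 4 (S.C510 * S.E₀) S.δ₁)) K g
              (S.cpl ⟨K, m, g₀⟩) := by
  have hT := theorem2Statement_of_letters hH hD hγ₀ hb hbb' hcont hlo hup
  exact ⟨hT, fun m => theorem2_rate_le_betaPrime510_of_upper hT hD hC hγ₀ hup hH.hγ m⟩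

end

end Summit.QuantumFields.BalabanUV.Beta.EriceFlowEnclosureB12AsPrintedEnd
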